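import Summits.SmoothPoincare4.SmoothPoincare4.Theses.InformationMetricHadamard
import Literature.Geometry.Riemannian.RiemannianMetricComap
import Literature.Geometry.Riemannian.RiemannianMeasureIsometry
import Literature.Geometry.Lorentzian.LocalIsometryScalarCurvature
import Literature.Geometry.Lorentzian.LeviCivitaProofs
import HarnessLib

/-!
# Transport of the Yamabe lower bound along a diffeomorphism
(helper `helper_yamabeBound_transport` of line `Sketch` (cork-round-refill), crux
`YamabeExtremalSpheres`, item stmt-SmoothPoincare4-7998; consumed by
`Theorems/YamabeExtremalSpheres/Negative/OfSmoothPoincare4.lean`)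

Let `Φ : M → N` be a `C^∞` diffeomorphism of closed smooth `4`-manifolds and `gM = Φ^* gN`.
If every metric `h` on `N` pointwise conformal to `gN` satisfies the Yamabe-type lower bound
`c · √Vol(N, h) ≤ ∫_N scal_h dvol_h`, then every metric `h'` on `M` pointwise conformal to `gM`
satisfies `c · √Vol(M, h') ≤ ∫_M scal_{h'} dvol_{h'}`.

Proof. Put `h := (Φ⁻¹)^* h'` (`riemannianComap`); it is conformal to `gN` with factor
`ψ ∘ Φ⁻¹` (chain rule `dΦ ∘ dΦ⁻¹ = id`), so the hypothesis applies to `h`; and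
`Φ⁻¹ : (N, h) → (M, h')` is an isometric diffeomorphism, whence `Vol(N, h) = Vol(M, h')`
(`measurePreserving_riemannianMeasure`), `scal_h = scal_{h'} ∘ Φ⁻¹`
(`scalarCurvature_eq_of_val_eq_pullbackBilin`, O'Neill 1983, Ch. 3, Prop. 3.59) and
`∫_N scal_{h'} ∘ Φ⁻¹ dvol_h = ∫_M scal_{h'} dvol_{h'}` (`integral_comp_of_isometry`).

References: B. O'Neill, *Semi-Riemannian Geometry* (1983), Ch. 3, Def. 3.9, Prop. 3.59,
pp. 90–91 [ONeill1983]; H. Federer, *Geometric Measure Theory* (1969), §3.2.46 [Federer1969].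
-/

noncomputable section

-- every `Summit.SmoothPoincare4.SmoothPoincare4.…` name repeats the summit = sub-problem segment
-- (D-0017 layout)
set_option linter.dupNamespace false

open scoped Manifold ContDiff Topology
open Set Function Bundle MeasureTheory
open Literature.Geometry.Riemannian
open Literature.Geometry.Lorentzian Literature.Geometry.Lorentzian.PseudoRiemannianMetric

namespace Summit.SmoothPoincare4.SmoothPoincare4.Theorems.YamabeExtremalSpheres

/-! ## Differentials of a diffeomorphism and of its inverse -/

section Diffeo

variable {E₁ : Type*} [NormedAddCommGroup E₁] [NormedSpace ℝ E₁] {H₁ : Type*} [TopologicalSpace H₁]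
  {I₁ : ModelWithCorners ℝ E₁ H₁} {M₁ : Type*} [TopologicalSpace M₁] [ChartedSpace H₁ M₁]
  {E₂ : Type*} [NormedAddCommGroup E₂] [NormedSpace ℝ E₂] {H₂ : Type*} [TopologicalSpace H₂]
  {I₂ : ModelWithCorners ℝ E₂ H₂} {M₂ : Type*} [TopologicalSpace M₂] [ChartedSpace H₂ M₂]

/-- `∞ + 1 ≤ ∞` in `ℕ∞ω` (cast bookkeeping: `∞ = ↑(⊤ : ℕ∞)`). [folklore] -/
theorem infty_add_one_le : (∞ : ℕ∞ω) + 1 ≤ ∞ := by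
  exact_mod_cast (le_top : (⊤ : ℕ∞) + 1 ≤ ⊤)

/-- For a `C^∞` diffeomorphism `Φ : M₁ → M₂`, `dΦ_{Φ⁻¹ y} (d(Φ⁻¹)_y v) = v` (chain rule applied to
`Φ ∘ Φ⁻¹ = id`; Lee 2013, Prop. 3.6). [folklore] -/
theorem mfderiv_apply_mfderiv_symm (Φ : M₁ ≃ₘ⟮I₁, I₂⟯ M₂) (y : M₂) (v : TangentSpace I₂ y) :
    mfderiv I₁ I₂ Φ (Φ.symm y) (mfderiv I₂ I₁ Φ.symm y v) = v := by
  have hn : (∞ : ℕ∞ω) ≠ 0 := by simp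
  have hc : mfderiv I₂ I₂ (Φ ∘ Φ.symm) y =
      (mfderiv I₁ I₂ Φ (Φ.symm y)).comp (mfderiv I₂ I₁ Φ.symm y) :=
    mfderiv_comp y (Φ.mdifferentiable hn (Φ.symm y)) (Φ.symm.mdifferentiable hn y)
  have hid : mfderiv I₂ I₂ (Φ ∘ Φ.symm) y = ContinuousLinearMap.id ℝ (TangentSpace I₂ y) := by
    have hcomp : ((Φ : M₁ → M₂) ∘ (Φ.symm : M₂ → M₁)) = id := funext fun z ↦ Φ.apply_symm_apply z
    rw [hcomp]
    exact mfderiv_id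
  exact DFunLike.congr_fun (hc.symm.trans hid) v

/-- The differential of the inverse of a `C^∞` diffeomorphism is injective (it has the left
inverse `dΦ`). [folklore] -/
theorem injective_mfderiv_symm (Φ : M₁ ≃ₘ⟮I₁, I₂⟯ M₂) (y : M₂) :
    Injective (mfderiv I₂ I₁ Φ.symm y) := fun v w hvw ↦ by
  rw [← mfderiv_apply_mfderiv_symm Φ y v, ← mfderiv_apply_mfderiv_symm Φ y w, hvw]

end Diffeo

/-! ## Volume and total scalar curvature under an isometric diffeomorphism -/

section Isometry

variable {m : ℕ} {M : Type*} [TopologicalSpace M] [ChartedSpace (EuclideanSpace ℝ (Fin m)) M]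
  [IsManifold (𝓡 m) ∞ M] [T3Space M] [MeasurableSpace M] [BorelSpace M]
  {N : Type*} [TopologicalSpace N] [ChartedSpace (EuclideanSpace ℝ (Fin m)) N]
  [IsManifold (𝓡 m) ∞ N] [T3Space N] [MeasurableSpace N] [BorelSpace N]
  (Ψ : N ≃ₘ⟮𝓡 m, 𝓡 m⟯ M)
  (h : ContMDiffRiemannianMetric (𝓡 m) ∞ (EuclideanSpace ℝ (Fin m))
    (TangentSpace (𝓡 m) : N → Type _))
  (h' : ContMDiffRiemannianMetric (𝓡 m) ∞ (EuclideanSpace ℝ (Fin m))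
    (TangentSpace (𝓡 m) : M → Type _))
  (hval : ∀ (y : N) (v w : TangentSpace (𝓡 m) y),
    h.inner y v w = h'.inner (Ψ y) (mfderiv (𝓡 m) (𝓡 m) Ψ y v) (mfderiv (𝓡 m) (𝓡 m) Ψ y w))

include hval

/-- **An isometric diffeomorphism is measure preserving**: if `Ψ : (N, h) → (M, h')` is a `C^∞`
diffeomorphism with `h = Ψ^* h'`, then `Ψ_* dvol_h = dvol_{h'}`
(`measurePreserving_riemannianMeasure`). Federer 1969, §3.2.46. [cite: Federer1969, §3.2.46] -/
theorem measurePreserving_of_diffeomorph_of_inner_eq :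
    MeasurePreserving Ψ (riemannianMeasure h) (riemannianMeasure h') :=
  measurePreserving_riemannianMeasure h h' (Ψ' := Ψ.symm) (Ψ.contMDiff.of_le (by norm_cast))
    (Ψ.symm.contMDiff.of_le (by norm_cast)) Ψ.symm_apply_apply Ψ.apply_symm_apply
    (fun y v ↦ (hval y v v).symm) rfl

/-- **Isometric diffeomorphisms preserve the total volume**: `Vol(N, Ψ^* h') = Vol(M, h')`.
[cite: Federer1969, §3.2.46] -/
theorem riemannianMeasure_univ_eq_of_diffeomorph_of_inner_eq :
    riemannianMeasure h univ = riemannianMeasure h' univ := by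
  rw [← (measurePreserving_of_diffeomorph_of_inner_eq Ψ h h' hval).measure_preimage
    MeasurableSet.univ.nullMeasurableSet, preimage_univ]

omit [T3Space M] [MeasurableSpace M] [BorelSpace M] [T3Space N] [MeasurableSpace N]
  [BorelSpace N] in
/-- **Isometric diffeomorphisms preserve the scalar curvature**: `scal_{Ψ^* h'}(y) = scal_{h'}(Ψ y)`
(O'Neill 1983, Ch. 3, Prop. 3.59, in the tree `scalarCurvature_eq_of_val_eq_pullbackBilin` on
`U = univ`). [cite: ONeill1983, Ch. 3, Prop. 3.59] -/
theorem scalarCurvature_eq_of_diffeomorph_of_inner_eq [(ofRiemannian h).HasLeviCivita]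
    [(ofRiemannian h').HasLeviCivita] (y : N) :
    (ofRiemannian h).scalarCurvature y = (ofRiemannian h').scalarCurvature (Ψ y) :=
  scalarCurvature_eq_of_val_eq_pullbackBilin (ofRiemannian h') (ofRiemannian h) isOpen_univ
    (fun q _ ↦ Ψ.contMDiff q) (fun q _ ↦ injective_mfderiv_symm Ψ.symm q) rfl
    (fun q _ ↦ ContinuousLinearMap.ext fun v ↦ ContinuousLinearMap.ext fun w ↦ by
      rw [pullbackBilin_apply, val_ofRiemannian, val_ofRiemannian]
      exact hval q v w)
    (mem_univ y)

/-- **Isometric diffeomorphisms preserve the total scalar curvature**: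
`∫_N scal_{Ψ^* h'} dvol_{Ψ^* h'} = ∫_M scal_{h'} dvol_{h'}` (pointwise invariance of the scalar
curvature and the change of variables `integral_comp_of_isometry`).
[cite: ONeill1983, Ch. 3, Prop. 3.59] -/
theorem integral_scalarCurvature_eq_of_diffeomorph_of_inner_eq [(ofRiemannian h).HasLeviCivita]
    [(ofRiemannian h').HasLeviCivita] :
    ∫ y, (ofRiemannian h).scalarCurvature y ∂(riemannianMeasure h) =
      ∫ x, (ofRiemannian h').scalarCurvature x ∂(riemannianMeasure h') := by
  simp only [scalarCurvature_eq_of_diffeomorph_of_inner_eq Ψ h h' hval]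
  exact integral_comp_of_isometry h h' (Ψ' := Ψ.symm) (Ψ.contMDiff.of_le (by norm_cast))
    (Ψ.symm.contMDiff.of_le (by norm_cast)) Ψ.symm_apply_apply Ψ.apply_symm_apply
    (fun y v ↦ (hval y v v).symm) rfl (fun x ↦ (ofRiemannian h').scalarCurvature x)

end Isometry

/-! ## The stub -/

/-- **Transport of the Yamabe lower bound along a diffeomorphism.** Let `Φ : M → N` be a `C^∞`
diffeomorphism of closed smooth `4`-manifolds with `gM = Φ^* gN`
(`gM_x(v, w) = gN_{Φ x}(dΦ v, dΦ w)`). If `c · √Vol(N, h) ≤ ∫_N scal_h dvol_h` for every metric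
`h` on `N` pointwise conformal to `gN`, then `c · √Vol(M, h') ≤ ∫_M scal_{h'} dvol_{h'}` for every
metric `h'` on `M` pointwise conformal to `gM`: apply the hypothesis to `h := (Φ⁻¹)^* h'`
(`riemannianComap`, conformal to `gN` with factor `ψ ∘ Φ⁻¹` by the chain rule
`dΦ ∘ dΦ⁻¹ = id`), and use that `Φ⁻¹ : (N, h) → (M, h')` is an isometric diffeomorphism, so
that `Vol(N, h) = Vol(M, h')` and `∫_N scal_h dvol_h = ∫_M scal_{h'} dvol_{h'}` (O'Neill 1983,
Ch. 3, Prop. 3.59; Federer 1969, §3.2.46). [cite: ONeill1983, Ch. 3, Prop. 3.59] -/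
theorem helper_yamabeBound_transport :
    ∀ (M : Type) [TopologicalSpace M] [T2Space M] [SecondCountableTopology M]
      [ChartedSpace (EuclideanSpace ℝ (Fin 4)) M] [IsManifold (𝓡 4) ∞ M] [CompactSpace M]
      [MeasurableSpace M] [BorelSpace M]
      (N : Type) [TopologicalSpace N] [T2Space N] [SecondCountableTopology N]
      [ChartedSpace (EuclideanSpace ℝ (Fin 4)) N] [IsManifold (𝓡 4) ∞ N] [CompactSpace N]
      [MeasurableSpace N] [BorelSpace N]
      (Φ : M ≃ₘ⟮𝓡 4, 𝓡 4⟯ N)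
      (gM : Bundle.ContMDiffRiemannianMetric (𝓡 4) ∞ (EuclideanSpace ℝ (Fin 4))
        (TangentSpace (𝓡 4) : M → Type _))
      (gN : Bundle.ContMDiffRiemannianMetric (𝓡 4) ∞ (EuclideanSpace ℝ (Fin 4))
        (TangentSpace (𝓡 4) : N → Type _)) (c : ℝ),
      (∀ (x : M) (v w : TangentSpace (𝓡 4) x),
        gM.inner x v w = gN.inner (Φ x) (mfderiv (𝓡 4) (𝓡 4) Φ x v) (mfderiv (𝓡 4) (𝓡 4) Φ x w)) →
      (∀ (h : Bundle.ContMDiffRiemannianMetric (𝓡 4) ∞ (EuclideanSpace ℝ (Fin 4))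
          (TangentSpace (𝓡 4) : N → Type _)) [(ofRiemannian h).HasLeviCivita],
        (∃ ψ : N → ℝ, ∀ y : N, 0 < ψ y ∧ ∀ v w : TangentSpace (𝓡 4) y,
            h.inner y v w = ψ y * gN.inner y v w) →
          c * Real.sqrt ((riemannianMeasure h Set.univ).toReal) ≤
            ∫ y, (ofRiemannian h).scalarCurvature y ∂(riemannianMeasure h)) →
      ∀ (h' : Bundle.ContMDiffRiemannianMetric (𝓡 4) ∞ (EuclideanSpace ℝ (Fin 4))
          (TangentSpace (𝓡 4) : M → Type _)) [(ofRiemannian h').HasLeviCivita],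
        (∃ ψ : M → ℝ, ∀ x : M, 0 < ψ x ∧ ∀ v w : TangentSpace (𝓡 4) x,
            h'.inner x v w = ψ x * gM.inner x v w) →
          c * Real.sqrt ((riemannianMeasure h' Set.univ).toReal) ≤
            ∫ x, (ofRiemannian h').scalarCurvature x ∂(riemannianMeasure h') := by
  intro M _ _ _ _ _ _ _ _ N _ _ _ _ _ _ _ _ Φ gM gN c hΦ hN h' _ hconf
  obtain ⟨ψ, hψ⟩ := hconf
  -- the transported metric `h = (Φ⁻¹)^* h'` on `N`
  have hΨs : ContMDiff (𝓡 4) (𝓡 4) (∞ + 1) Φ.symm := Φ.symm.contMDiff.of_le infty_add_one_le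
  obtain ⟨h, hh⟩ : ∃ h : Bundle.ContMDiffRiemannianMetric (𝓡 4) ∞ (EuclideanSpace ℝ (Fin 4))
      (TangentSpace (𝓡 4) : N → Type _), ∀ (y : N) (v w : TangentSpace (𝓡 4) y),
      h.inner y v w = h'.inner (Φ.symm y) (mfderiv (𝓡 4) (𝓡 4) Φ.symm y v)
        (mfderiv (𝓡 4) (𝓡 4) Φ.symm y w) :=
    ⟨riemannianComap h' Φ.symm hΨs (injective_mfderiv_symm Φ) rfl, fun _ _ _ ↦ rfl⟩
  haveI := (ofRiemannian h).hasLeviCivita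
  -- `h` is pointwise conformal to `gN` with factor `ψ ∘ Φ⁻¹`
  have hconfN : ∃ ψ' : N → ℝ, ∀ y : N, 0 < ψ' y ∧ ∀ v w : TangentSpace (𝓡 4) y,
      h.inner y v w = ψ' y * gN.inner y v w := by
    refine ⟨ψ ∘ Φ.symm, fun y ↦ ⟨(hψ (Φ.symm y)).1, fun v w ↦ ?_⟩⟩
    rw [hh, (hψ (Φ.symm y)).2, hΦ (Φ.symm y), mfderiv_apply_mfderiv_symm Φ y v,
      mfderiv_apply_mfderiv_symm Φ y w]
    exact congrArg (fun z : N ↦ ψ (Φ.symm y) *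
      gN.inner z (show TangentSpace (𝓡 4) z from v) (show TangentSpace (𝓡 4) z from w))
      (Φ.apply_symm_apply y)
  -- the bound for `h` on `N`, read through the isometric diffeomorphism `Φ⁻¹ : (N, h) → (M, h')`
  have hbound := hN h hconfN
  rwa [riemannianMeasure_univ_eq_of_diffeomorph_of_inner_eq Φ.symm h h' hh,
    integral_scalarCurvature_eq_of_diffeomorph_of_inner_eq Φ.symm h h' hh] at hbound

end Summit.SmoothPoincare4.SmoothPoincare4.Theorems.YamabeExtremalSpheres

end
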